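import Literature.AlgebraicGeometry.Modules.UnitCocycle
import Literature.AlgebraicGeometry.Modules.LocalFrames
import Mathlib.Topology.Sheaves.SheafCondition.UniqueGluing
import HarnessLib

/-!
# The line bundle glued from a Čech `1`-cocycle of units

For a cocycle `c = (U_x, g_{xy})` of units of `𝒪_X` on a point-indexed cover of a scheme `X`
(`Modules/UnitCocycle.lean`) we construct the `𝒪_X`-module `lineBundle c` obtained by gluing the
`𝒪_{U_x}` along the `g_{xy}` (Hartshorne II Ex. 1.22 (glueing sheaves) and III Ex. 4.5: every Čech
class in `Ȟ¹(X, 𝒪_X^×)` is the class of a line bundle), concretely: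

  `Γ(lineBundle c, V) = { (s_x)_x : s_x ∈ Γ(X, V ⊓ U_x), s_x = g_{xy} s_y on every V' ≤ V ⊓ U_x ⊓ U_y }`

(a sub-`𝒪_X(V)`-module of `∏_x Γ(X, V ⊓ U_x)`, restriction componentwise; the sheaf condition is
checked componentwise with the sheaf `𝒪_X`). Over `U_z` it is trivial: `lineBundleTriv c z :
𝒪|_{U_z} ≅ (lineBundle c)|_{U_z}`, `r ↦ r · t_z` with the generator `t_z = (g_{xz})_x`
(`lineBundleGen`), which satisfies `t_w = g_{zw} t_z` (`lineBundleGen_eq_smul`) — so the transition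
functions of these trivialisations are the `g_{zw}` again (`Modules/LineBundleOfCocycleClass.lean`).
Everything is proved; no named facts.

## References

* R. Hartshorne, *Algebraic Geometry*, GTM 52 (1977), II Ex. 1.22, III Ex. 4.5. [Hartshorne1977]
-/

noncomputable section

open CategoryTheory AlgebraicGeometry Opposite TopologicalSpace Limits

namespace Literature.AlgebraicGeometry.Modules

universe u

variable {X : Scheme.{u}} (c : UnitCocycle X)

namespace UnitCocycle

/-! ### Glue families -/

/-- A family `s_x ∈ Γ(X, V ⊓ U_x)` is a **glue family** if `s_x = g_{xy} s_y` on every open below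
`V`, `U_x` and `U_y`. [folklore] -/
def IsGlueFamily (V : X.Opens) (s : ∀ x : X, Γ(X, V ⊓ c.U x)) : Prop :=
  ∀ (x y : X) (V' : X.Opens) (hV : V' ≤ V) (hx : V' ≤ c.U x) (hy : V' ≤ c.U y),
    secRes X (le_inf hV hx) (s x) = c.g x y V' hx hy * secRes X (le_inf hV hy) (s y)

/-- The `Γ(X, V)`-module structure on `Γ(X, V ⊓ U_x)` by restriction (local instance). [folklore] -/
@[reducible]
def pieceModule (V : X.Opens) (x : X) : Module Γ(X, V) Γ(X, V ⊓ c.U x) :=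
  Module.compHom _ (secRes X (inf_le_left : V ⊓ c.U x ≤ V))

attribute [local instance] pieceModule

/-- Unfolding the scalar action on a piece. [folklore] -/
lemma piece_smul_def (V : X.Opens) (x : X) (r : Γ(X, V)) (a : Γ(X, V ⊓ c.U x)) :
    r • a = secRes X (inf_le_left : V ⊓ c.U x ≤ V) r * a := rfl

/-- **The sections of the glued line bundle over `V`**: the glue families, a submodule of
`∏_x Γ(X, V ⊓ U_x)`. [folklore] -/
def glueSubmodule (V : X.Opens) : Submodule Γ(X, V) (∀ x : X, Γ(X, V ⊓ c.U x)) where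
  carrier := {s | c.IsGlueFamily V s}
  zero_mem' x y V' hV hx hy := by simp only [Pi.zero_apply, map_zero, mul_zero]
  add_mem' {s t} hs ht x y V' hV hx hy := by
    simp only [Pi.add_apply, map_add, hs x y V' hV hx hy, ht x y V' hV hx hy, mul_add]
  smul_mem' r s hs x y V' hV hx hy := by
    simp only [Pi.smul_apply, piece_smul_def, map_mul, secRes_secRes, hs x y V' hV hx hy]
    ring

/-- Membership in `glueSubmodule`. [folklore] -/
lemma mem_glueSubmodule_iff (V : X.Opens) (s : ∀ x : X, Γ(X, V ⊓ c.U x)) :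
    s ∈ c.glueSubmodule V ↔ c.IsGlueFamily V s := Iff.rfl

/-- Restriction of glue families along `V' ≤ V` (componentwise). [folklore] -/
def glueRestrict {V V' : X.Opens} (i : V' ≤ V) : c.glueSubmodule V →+ c.glueSubmodule V' where
  toFun s := ⟨fun x => secRes X (inf_le_inf_right (c.U x) i) (s.1 x), fun x y W hV hx hy => by
    rw [secRes_secRes, secRes_secRes]
    exact s.2 x y W (hV.trans i) hx hy⟩
  map_zero' := by
    ext x
    exact map_zero _
  map_add' s t := by
    ext x
    exact map_add _ _ _

/-- Components of a restricted glue family. [folklore] -/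
@[simp]
lemma glueRestrict_apply {V V' : X.Opens} (i : V' ≤ V) (s : c.glueSubmodule V) (x : X) :
    (c.glueRestrict i s).1 x = secRes X (inf_le_inf_right (c.U x) i) (s.1 x) := rfl

/-- Restriction of glue families is semilinear. [folklore] -/
lemma glueRestrict_smul {V V' : X.Opens} (i : V' ≤ V) (r : Γ(X, V)) (s : c.glueSubmodule V) :
    c.glueRestrict i (r • s) = secRes X i r • c.glueRestrict i s := by
  ext x
  change secRes X _ (secRes X _ r * s.1 x) = secRes X _ (secRes X i r) * secRes X _ (s.1 x)
  rw [map_mul, secRes_secRes, secRes_secRes]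

/-- **The presheaf of abelian groups `V ↦ {glue families over V}`.** [folklore] -/
def gluePresheafAb : TopCat.Presheaf Ab X where
  obj V := AddCommGrpCat.of (c.glueSubmodule V.unop)
  map i := AddCommGrpCat.ofHom (c.glueRestrict i.unop.le)
  map_id V := by
    refine AddCommGrpCat.ext fun s => Subtype.ext (funext fun x => ?_)
    exact secRes_self _
  map_comp i j := by
    refine AddCommGrpCat.ext fun s => Subtype.ext (funext fun x => ?_)
    exact (secRes_secRes _ _ _).symm

/-- The restriction maps of `gluePresheafAb`. [folklore] -/
@[simp]
lemma gluePresheafAb_map_apply {V V' : (X.Opens)ᵒᵖ} (i : V ⟶ V') (s : c.glueSubmodule V.unop) :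
    (c.gluePresheafAb.map i) s = c.glueRestrict i.unop.le s := rfl

/-- The presheaf of `𝒪_X`-modules of glue families. [folklore] -/
def gluePresheaf : X.PresheafOfModules :=
  @PresheafOfModules.ofPresheaf _ _ X.ringCatSheaf.obj c.gluePresheafAb
    (fun V => Submodule.module (c.glueSubmodule V.unop)) (fun _ _ i r s => c.glueRestrict_smul i.unop.le r s)

/-! ### The sheaf condition -/

/-- Gluing glue families: a compatible family of glue families over an open cover glues uniquely
(componentwise, by the sheaf property of `𝒪_X` on the cover `V_i ⊓ U_x` of `(⨆ V_i) ⊓ U_x`).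
[folklore] -/
theorem gluePresheafAb_isSheaf : TopCat.Presheaf.IsSheaf c.gluePresheafAb := by
  rw [TopCat.Presheaf.isSheaf_iff_isSheafUniqueGluing]
  intro ι V sf hsf
  -- componentwise gluing in `𝒪_X`
  have hcov : ∀ x : X, (iSup V) ⊓ c.U x ≤ ⨆ i, V i ⊓ c.U x := fun x => by
    rw [← iSup_inf_eq]
  have hcompat : ∀ x : X, TopCat.Presheaf.IsCompatible X.presheaf (fun i => V i ⊓ c.U x)
      (fun i => (sf i).1 x) := by
    intro x i j
    have h := congrArg (fun s : c.glueSubmodule (V i ⊓ V j) => s.1 x) (hsf i j)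
    simp only [gluePresheafAb_map_apply, glueRestrict_apply] at h
    change secRes X _ ((sf i).1 x) = secRes X _ ((sf j).1 x)
    have e₁ : V i ⊓ c.U x ⊓ (V j ⊓ c.U x) ≤ V i ⊓ V j ⊓ c.U x :=
      le_inf (inf_le_inf inf_le_left inf_le_left) (inf_le_left.trans inf_le_right)
    rw [← secRes_secRes (inf_le_inf_right (c.U x) (inf_le_left : V i ⊓ V j ≤ V i)) e₁,
      ← secRes_secRes (inf_le_inf_right (c.U x) (inf_le_right : V i ⊓ V j ≤ V j)) e₁]
    exact congrArg _ h
  choose t ht htu using fun x => TopCat.Sheaf.existsUnique_gluing' X.sheaf (fun i => V i ⊓ c.U x)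
    ((iSup V) ⊓ c.U x) (fun i => homOfLE (inf_le_inf_right (c.U x) (le_iSup V i))) (hcov x)
    (fun i => (sf i).1 x) (hcompat x)
  -- `t x ∈ Γ(X, (⨆ V_i) ⊓ U_x)` restricts to `(sf i).x` on `V_i ⊓ U_x`
  have ht' : ∀ x i, secRes X (inf_le_inf_right (c.U x) (le_iSup V i)) (t x) = (sf i).1 x := ht
  -- the glued family is a glue family: check the relation locally on `V' ⊓ V_i`
  have hglue : c.IsGlueFamily (iSup V) t := by
    intro x y V' hV hx hy
    apply TopCat.Sheaf.eq_of_locally_eq' X.sheaf (fun i => V' ⊓ V i) V'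
      (fun i => homOfLE inf_le_left)
      (by rw [← inf_iSup_eq]; exact le_inf le_rfl hV)
    intro i
    change secRes X inf_le_left _ = secRes X inf_le_left _
    rw [map_mul, secRes_secRes, secRes_secRes, c.map_g]
    have h := (sf i).2 x y (V' ⊓ V i) inf_le_right (inf_le_left.trans hx) (inf_le_left.trans hy)
    rw [← ht' x i, ← ht' y i, secRes_secRes, secRes_secRes] at h
    exact h
  refine ⟨⟨t, hglue⟩, fun i => Subtype.ext (funext fun x => ht' x i), ?_⟩
  -- uniqueness
  intro s hs
  refine Subtype.ext (funext fun x => htu x (s.1 x) fun i => ?_)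
  have h := congrArg (fun s : c.glueSubmodule (V i) => s.1 x) (hs i)
  exact h

variable (X) in
/-- Sections over the whole space as an instance check: the presheaf of modules of glue families
is a sheaf. [folklore] -/
lemma gluePresheaf_isSheaf : Presheaf.IsSheaf (Opens.grothendieckTopology X) c.gluePresheaf.presheaf :=
  c.gluePresheafAb_isSheaf

end UnitCocycle

/-- **The line bundle glued from a cocycle of units** `c = (U_x, g_{xy})`: the `𝒪_X`-module of glue
families `(s_x ∈ Γ(X, V ⊓ U_x))_x`, `s_x = g_{xy} s_y` (Hartshorne II Ex. 1.22, III Ex. 4.5).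
[cite: Hartshorne1977, III Ex. 4.5] -/
def lineBundle : X.Modules where
  val := c.gluePresheaf
  isSheaf := c.gluePresheafAb_isSheaf

namespace UnitCocycle

/-! ### Sections of the glued line bundle -/

/-- The `x`-component `s_x ∈ Γ(X, V ⊓ U_x)` of a section of the glued line bundle. [folklore] -/
def comp {V : X.Opens} (s : Γ(lineBundle c, V)) (x : X) : Γ(X, V ⊓ c.U x) :=
  (s : c.glueSubmodule V).1 x

/-- Sections of the glued line bundle are determined by their components. [folklore] -/
@[ext]
lemma section_ext {V : X.Opens} {s t : Γ(lineBundle c, V)} (h : ∀ x, c.comp s x = c.comp t x) :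
    s = t :=
  Subtype.ext (funext h)

/-- The glue relation of a section. [folklore] -/
lemma comp_rel {V : X.Opens} (s : Γ(lineBundle c, V)) (x y : X) (V' : X.Opens) (hV : V' ≤ V)
    (hx : V' ≤ c.U x) (hy : V' ≤ c.U y) :
    secRes X (le_inf hV hx) (c.comp s x) = c.g x y V' hx hy * secRes X (le_inf hV hy) (c.comp s y) :=
  (s : c.glueSubmodule V).2 x y V' hV hx hy

/-- Components of a restricted section. [folklore] -/
@[simp]
lemma comp_map {V V' : X.Opens} (i : V' ⟶ V) (s : Γ(lineBundle c, V)) (x : X) :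
    c.comp ((lineBundle c).presheaf.map i.op s) x = secRes X (inf_le_inf_right (c.U x) i.le) (c.comp s x) :=
  rfl

/-- Components of a sum. [folklore] -/
@[simp]
lemma comp_add {V : X.Opens} (s t : Γ(lineBundle c, V)) (x : X) :
    c.comp (s + t) x = c.comp s x + c.comp t x := rfl

/-- Components of a scalar multiple. [folklore] -/
@[simp]
lemma comp_smul {V : X.Opens} (r : Γ(X, V)) (s : Γ(lineBundle c, V)) (x : X) :
    c.comp (r • s) x = secRes X (inf_le_left : V ⊓ c.U x ≤ V) r * c.comp s x := rfl

/-- A section of the glued line bundle from a glue family. [folklore] -/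
def mkSection (V : X.Opens) (s : ∀ x : X, Γ(X, V ⊓ c.U x)) (hs : c.IsGlueFamily V s) :
    Γ(lineBundle c, V) :=
  (⟨s, hs⟩ : c.glueSubmodule V)

/-- Components of `mkSection`. [folklore] -/
@[simp]
lemma comp_mkSection (V : X.Opens) (s : ∀ x : X, Γ(X, V ⊓ c.U x)) (hs : c.IsGlueFamily V s) (x : X) :
    c.comp (c.mkSection V s hs) x = s x := rfl

/-! ### The local generator and the local trivialisation -/

/-- **The local generator `t_z = (g_{xz})_x` of the glued line bundle over `V ≤ U_z`.** [folklore] -/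
def lineBundleGen (z : X) (V : X.Opens) (h : V ≤ c.U z) : Γ(lineBundle c, V) :=
  c.mkSection V (fun x => c.g x z (V ⊓ c.U x) inf_le_right (inf_le_left.trans h))
    fun x y V' hV hx hy => by
      rw [c.map_g, c.map_g, c.g_mul]

/-- Components of the local generator. [folklore] -/
@[simp]
lemma comp_lineBundleGen (z : X) (V : X.Opens) (h : V ≤ c.U z) (x : X) :
    c.comp (c.lineBundleGen z V h) x = c.g x z (V ⊓ c.U x) inf_le_right (inf_le_left.trans h) := rfl

/-- The local generator restricts to the local generator. [folklore] -/
lemma map_lineBundleGen (z : X) {V V' : X.Opens} (h : V ≤ c.U z) (i : V' ⟶ V) :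
    (lineBundle c).presheaf.map i.op (c.lineBundleGen z V h) = c.lineBundleGen z V' (i.le.trans h) := by
  ext x
  rw [comp_map, comp_lineBundleGen, comp_lineBundleGen, c.map_g]

/-- **`t_w = g_{zw} t_z`** over `V ≤ U_z ⊓ U_w`. [folklore] -/
theorem lineBundleGen_eq_smul (z w : X) (V : X.Opens) (hz : V ≤ c.U z) (hw : V ≤ c.U w) :
    c.lineBundleGen w V hw = c.g z w V hz hw • c.lineBundleGen z V hz := by
  ext x
  rw [comp_lineBundleGen, comp_smul, comp_lineBundleGen, c.map_g, mul_comm, c.g_mul]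

/-- Every section over `V ≤ U_z` is a multiple of the local generator: `s = s_z|_V · t_z`.
[folklore] -/
theorem eq_smul_lineBundleGen (z : X) (V : X.Opens) (h : V ≤ c.U z) (s : Γ(lineBundle c, V)) :
    s = secRes X (le_inf le_rfl h : V ≤ V ⊓ c.U z) (c.comp s z) • c.lineBundleGen z V h := by
  ext x
  rw [comp_smul, comp_lineBundleGen, secRes_secRes, mul_comm]
  have hr := c.comp_rel s x z (V ⊓ c.U x) inf_le_left inf_le_right (inf_le_left.trans h)
  rw [show secRes X (le_inf inf_le_left inf_le_right : V ⊓ c.U x ≤ V ⊓ c.U x) (c.comp s x) =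
    c.comp s x from secRes_self _] at hr
  exact hr

/-- The inverse local trivialisation `(lineBundle c)|_{U_z} → 𝒪|_{U_z}`, `s ↦ s_z`. [folklore] -/
def lineBundleTrivInv (z : X) : (lineBundle c).over (c.U z) ⟶ (unitModule X).over (c.U z) where
  val := PresheafOfModules.homMk
    { app := fun V => AddCommGrpCat.ofHom
        { toFun := fun s => (secRes X (le_inf le_rfl V.unop.hom.le) (c.comp s z) : Γ(X, V.unop.left))
          map_zero' := by
            change secRes X _ (c.comp (0 : Γ(lineBundle c, V.unop.left)) z) = 0
            exact map_zero _
          map_add' := fun s t => by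
            change secRes X _ (c.comp s z + c.comp t z) = _
            exact map_add _ _ _ }
      naturality := fun {V W} i => by
        ext s
        change secRes X _ (secRes X _ (c.comp s z)) = secRes X i.unop.left.le (secRes X _ (c.comp s z))
        rw [secRes_secRes, secRes_secRes] }
    (fun V (r : Γ(X, V.unop.left)) (s : Γ(lineBundle c, V.unop.left)) => by
      change secRes X (V' := V.unop.left) _ (c.comp (r • s) z) =
        r * secRes X (V' := V.unop.left) _ (c.comp s z)
      rw [comp_smul, map_mul, secRes_secRes, secRes_self])

/-- Values of the inverse local trivialisation. [folklore] -/
lemma appLE_lineBundleTrivInv (z : X) {W : X.Opens} (k : W ⟶ c.U z) (s : Γ(lineBundle c, W)) :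
    appLE (c.lineBundleTrivInv z) k s = secRes X (le_inf le_rfl k.le) (c.comp s z) := rfl

/-- **The local trivialisation `𝒪|_{U_z} ≅ (lineBundle c)|_{U_z}`, `r ↦ r · t_z`.** [folklore] -/
def lineBundleTriv (z : X) : (unitModule X).over (c.U z) ≅ (lineBundle c).over (c.U z) where
  hom := smulSection (c.lineBundleGen z (c.U z) le_rfl)
  inv := c.lineBundleTrivInv z
  hom_inv_id := by
    refine hom_ext_of_appLE fun W k r => ?_
    rw [appLE_comp, appLE_smulSection, map_lineBundleGen, appLE_lineBundleTrivInv, appLE_id,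
      comp_smul, comp_lineBundleGen, c.g_self, mul_one, secRes_secRes, secRes_self]
  inv_hom_id := by
    refine hom_ext_of_appLE fun W k s => ?_
    rw [appLE_comp, appLE_lineBundleTrivInv, appLE_smulSection, map_lineBundleGen, appLE_id]
    exact (c.eq_smul_lineBundleGen z W k.le s).symm

/-- The local trivialisation is `r ↦ r · t_z|`. [folklore] -/
lemma appLE_lineBundleTriv_hom (z : X) {W : X.Opens} (k : W ⟶ c.U z) (r : Γ(X, W)) :
    appLE (c.lineBundleTriv z).hom k r = r • c.lineBundleGen z W k.le := by
  change appLE (smulSection _) k r = _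
  rw [appLE_smulSection, map_lineBundleGen]

end UnitCocycle

end Literature.AlgebraicGeometry.Modules

end
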